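import Mathlib
import Literature.NumberTheory.Sieve.LevelOfDistribution
import HarnessLib

/-!
# Polymath 8a, (1.1) and §3: the signed discrepancy `Δ(α; a (q))` and its behaviour under Dirichlet convolution

Support file for the named fact `Literature.NumberTheory.Sieve.mpz_of_lt` (**parity.S29**,
`ParityWave0.lean`): D. H. J. Polymath, *New equidistribution estimates of Zhang type*, Algebra &
Number Theory 8:9 (2014) 2067–2199 = arXiv:1402.0811.  Every estimate in the printed proof of
Theorem 2.4 (Claim 2.3, the Type I/II/III estimates of Definition 2.6, the Siegel–Walfisz property of
Definition 2.5, Lemma 2.7 and §3) is phrased through the signed discrepancy (1.1)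
`Δ(α; a (q)) := ∑_{n ≡ a (q)} α(n) − (1/φ(q)) ∑_{(n,q)=1} α(n)` of a finitely supported sequence `α`
in a residue class `a (q)`, applied to Dirichlet convolutions `α ⋆ β`.  The tree already has `Δ` as
`Literature.NumberTheory.Sieve.apDiscrepancy γ X q a` (`LevelOfDistribution.lean`, vendored for
Polymath 8b (1.1), the identical display), summed over the window `[1, X]`; this file PROVES, over
`apDiscrepancy`, the algebraic device by which §3 passes distribution information from one
convolution factor to the product ("we argue as in Lemma 3.4 (iii)"):

* `apDiscrepancy_eq_of_support` (the window is immaterial beyond the support) and the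
  triangle-inequality bound `abs_apDiscrepancy_le`;
* `sum_Icc_mul_apply_eq` — `∑_{n ≤ X} g(n) (α ⋆ β)(n) = ∑_{d ≤ X₁} ∑_{e ≤ X₂} g(de) α(d) β(e)` for
  `α`, `β` supported on `[1, X₁]`, `[1, X₂]`, `X₁ X₂ ≤ X` (`⋆` = Mathlib's product of
  `ArithmeticFunction`s, as in the tree's `heathBrown_identity`);
* `sum_congr_mul_apply_eq_sum_units`, `sum_coprime_mul_apply_eq`, `sum_filter_coprime_eq_sum_units`
  — the two displays of the proof of Lemma 3.4 (iii):
  `∑_{n ≡ a (r)} (α ⋆ β)(n) = ∑_{b ∈ (ℤ/rℤ)ˣ} (∑_{d ≡ b} α(d)) (∑_{m ≡ b̄ a} β(m))` and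
  `∑_n (α ⋆ β)(n) 1_{(n,r)=1} = (∑_{(d,r)=1} α(d)) (∑_{(m,r)=1} β(m))`;
* `apDiscrepancy_mul_eq_sum_units` — hence, for a primitive class,
  `Δ(α ⋆ β; a (q)) = ∑_{b ∈ (ℤ/qℤ)ˣ} (∑_{d ≡ b (q)} α(d)) Δ(β; b̄ a (q))` (the identity displayed in
  the Type 0 case of §3), and the bound `abs_apDiscrepancy_mul_le`:
  `|Δ(α ⋆ β; a (q))| ≤ (∑_d |α(d)|) · max_{b ∈ (ℤ/qℤ)ˣ} |Δ(β; b (q))|`, which is the inequality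
  `|Δ(α ⋆ β, a (r))| ≤ ∑_b |∑_{d ≡ b} α(d)| |Δ(β; b̄ a (r))|` of Lemma 3.4 (iii) and the display
  `∑_q |Δ(α_1 ⋆ ⋯ ⋆ α_{2j}; a (q))| ⪅ N_S ∑_{q ≤ Q} sup_b |Δ(α_k; b (q))|` of the Type 0 case.

* `abs_apDiscrepancy_coprime_mul_le` — Lemma 3.4 (iii), general case (the Siegel–Walfisz property
  passes from `β` to `α ⋆ β`), as the inequality
  `|Δ((α ⋆ β) 1_{(·,r)=1}; a (q))| ≤ (∑_d |α(d)|) · max_b |Δ(β 1_{(·,r)=1}; b (q))|` (restriction to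
  integers coprime to `r` commutes with `⋆`).

Design: sequences are real-valued `ℕ → ℝ` (Definition 2.5: "a coefficient sequence is a finitely
supported sequence `α : ℕ → ℝ`"), finite support is carried as the explicit window `[1, X]` of
`apDiscrepancy` plus vanishing hypotheses, and residues are `ZMod q` with `q ≠ 0` (`[NeZero q]`)
where units are summed.  (BFI's bracket form `apDiscrepancy_mul_eq_of_support`,
`BombieriFriedlanderIwaniecGrouping.lean`, expands `Δ(α ⋆ β)` over dyadic supports without sorting
`d` by residue; the unit-sorted form here is the one Polymath 8a §3 uses.)  Nothing here discharges
`mpz_of_lt`.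

## References

* D. H. J. Polymath, *New equidistribution estimates of Zhang type*, Algebra & Number Theory 8:9
  (2014), 2067–2199, arXiv:1402.0811: (1.1); §2.2 (the trivial estimate after Definition 2.5); §3,
  proof of Lemma 3.4 (iii) and the Type 0 case of the proof of Lemma 2.7. [cite: Polymath8a2014]
-/

open Finset

namespace Literature.NumberTheory.Sieve

namespace Polymath8a

/-- **Summing a Dirichlet convolution against a weight**: if `α` is supported on `[1, X₁]`, `β` on
`[1, X₂]` and `X₁ X₂ ≤ X`, then `∑_{n ≤ X} g(n) (α ⋆ β)(n) = ∑_{d ≤ X₁} ∑_{e ≤ X₂} g(de) α(d) β(e)`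
(re-index the pairs `de = n`). [folklore] -/
theorem sum_Icc_mul_apply_eq (α β : ArithmeticFunction ℝ) {X₁ X₂ X : ℕ}
    (hα : ∀ n, X₁ < n → α n = 0) (hβ : ∀ n, X₂ < n → β n = 0) (hX : X₁ * X₂ ≤ X) (g : ℕ → ℝ) :
    ∑ n ∈ Icc 1 X, g n * (α * β) n = ∑ d ∈ Icc 1 X₁, ∑ e ∈ Icc 1 X₂, g (d * e) * (α d * β e) := by
  classical
  have lhs : ∑ n ∈ Icc 1 X, g n * (α * β) n =
      ∑ p ∈ (Icc 1 X).sigma (fun n => n.divisorsAntidiagonal), g p.1 * (α p.2.1 * β p.2.2) := by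
    rw [Finset.sum_sigma]
    refine Finset.sum_congr rfl fun n _ => ?_
    rw [ArithmeticFunction.mul_apply, Finset.mul_sum]
  rw [lhs, ← Finset.sum_product']
  symm
  refine Finset.sum_of_injOn (fun p => (⟨p.1 * p.2, p⟩ : Σ _ : ℕ, ℕ × ℕ)) ?_ ?_ ?_ ?_
  · intro p _ p' _ h
    simpa using congrArg Sigma.snd h
  · intro p hp
    rw [Finset.mem_coe, Finset.mem_product, Finset.mem_Icc, Finset.mem_Icc] at hp
    rw [Finset.mem_coe, Finset.mem_sigma, Finset.mem_Icc, Nat.mem_divisorsAntidiagonal]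
    refine ⟨⟨Nat.mul_pos hp.1.1 hp.2.1, le_trans (Nat.mul_le_mul hp.1.2 hp.2.2) hX⟩, rfl, ?_⟩
    exact Nat.mul_ne_zero (by omega) (by omega)
  · rintro ⟨n, d, e⟩ hmem hnot
    simp only [Finset.mem_sigma, Finset.mem_Icc, Nat.mem_divisorsAntidiagonal] at hmem
    obtain ⟨⟨hn1, hnX⟩, hde, hn0⟩ := hmem
    have hd0 : d ≠ 0 := fun h => hn0 (by rw [← hde, h, zero_mul])
    have he0 : e ≠ 0 := fun h => hn0 (by rw [← hde, h, mul_zero])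
    -- not in the image: `d > X₁` or `e > X₂`
    have hbig : X₁ < d ∨ X₂ < e := by
      by_contra hc
      push Not at hc
      refine hnot ⟨(d, e), ?_, ?_⟩
      · simp only [Finset.coe_product, Set.mem_prod, Finset.mem_coe, Finset.mem_Icc]
        exact ⟨⟨Nat.pos_of_ne_zero hd0, hc.1⟩, Nat.pos_of_ne_zero he0, hc.2⟩
      · simp [hde]
    rcases hbig with h | h
    · simp [hα d h]
    · simp [hβ e h]
  · intro p _
    rfl

section Basic

variable {q : ℕ}

/-- The discrepancy does not depend on the length `X` of the window once it contains the support.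
[cite: Polymath8a2014, (1.1)] -/
theorem apDiscrepancy_eq_of_support (α : ℕ → ℝ) {X X' : ℕ} (h : ∀ n, X < n → α n = 0)
    (hX : X ≤ X') (a : ZMod q) : apDiscrepancy α X' q a = apDiscrepancy α X q a := by
  have key : ∀ P : ℕ → Prop, ∀ [DecidablePred P],
      ∑ n ∈ (Icc 1 X').filter P, α n = ∑ n ∈ (Icc 1 X).filter P, α n := by
    intro P _
    symm
    refine Finset.sum_subset (Finset.filter_subset_filter P (Finset.Icc_subset_Icc_right hX)) ?_
    intro n hn hn'
    rw [Finset.mem_filter, Finset.mem_Icc] at hn hn'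
    exact h n (by by_contra hc; exact hn' ⟨⟨hn.1.1, not_lt.mp hc⟩, hn.2⟩)
  rw [apDiscrepancy, apDiscrepancy, key, key]

/-- Triangle inequality for the discrepancy: `|Δ(α; a (q))| ≤ ∑_{n ≡ a} |α(n)| + (1/φ(q)) ∑_n |α(n)|`
(the first step of the "trivial estimate `Δ(α; a (q)) ≪ (N/φ(q)) (log x)^{O(1)}`" for a
coefficient sequence at scale `N`, Polymath 8a §2.2).
[cite: Polymath8a2014, §2.2, the trivial estimate after Definition 2.5] -/
theorem abs_apDiscrepancy_le (α : ℕ → ℝ) (X q : ℕ) (a : ZMod q) :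
    |apDiscrepancy α X q a| ≤ ∑ n ∈ Icc 1 X with ((n : ℕ) : ZMod q) = a, |α n| +
      (∑ n ∈ Icc 1 X, |α n|) / (q.totient : ℝ) := by
  rw [apDiscrepancy]
  refine (abs_sub _ _).trans (add_le_add (Finset.abs_sum_le_sum_abs _ _) ?_)
  rw [abs_div, Nat.abs_cast]
  refine div_le_div_of_nonneg_right ((Finset.abs_sum_le_sum_abs _ _).trans ?_) (Nat.cast_nonneg _)
  exact Finset.sum_le_sum_of_subset_of_nonneg (Finset.filter_subset _ _) fun n _ _ => abs_nonneg _

end Basic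

section Residues

variable {q : ℕ}

/-- Splitting a sum over `ℤ/qℤ` into units: if `F` vanishes off `(ℤ/qℤ)ˣ` then
`∑_{b ∈ ℤ/qℤ} F(b) = ∑_{u ∈ (ℤ/qℤ)ˣ} F(u)`. [folklore] -/
theorem sum_zmod_eq_sum_units [NeZero q] (F : ZMod q → ℝ) (hF : ∀ b, ¬IsUnit b → F b = 0) :
    ∑ b : ZMod q, F b = ∑ u : (ZMod q)ˣ, F u := by
  classical
  rw [← Finset.sum_image (f := F) (s := (Finset.univ : Finset (ZMod q)ˣ))
    (g := fun u : (ZMod q)ˣ => (u : ZMod q)) (fun u _ v _ h => Units.ext h)]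
  symm
  refine Finset.sum_subset (Finset.subset_univ _) fun b _ hb => hF b ?_
  rintro ⟨u, rfl⟩
  exact hb (Finset.mem_image.mpr ⟨u, Finset.mem_univ _, rfl⟩)

/-- Grouping a sum over naturals by residue class: `∑_d f(d) G(d mod q) = ∑_{b} (∑_{d ≡ b} f(d)) G(b)`.
[folklore] -/
theorem sum_mul_apply_natCast_eq [NeZero q] (s : Finset ℕ) (f : ℕ → ℝ) (G : ZMod q → ℝ) :
    ∑ d ∈ s, f d * G (d : ZMod q) =
      ∑ b : ZMod q, (∑ d ∈ s with ((d : ℕ) : ZMod q) = b, f d) * G b := by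
  classical
  rw [← Finset.sum_fiberwise s (fun d : ℕ => ((d : ℕ) : ZMod q)) (fun d => f d * G (d : ZMod q))]
  refine Finset.sum_congr rfl fun b _ => ?_
  rw [Finset.sum_mul]
  refine Finset.sum_congr rfl fun d hd => ?_
  rw [(Finset.mem_filter.mp hd).2]

/-- `∑_{d coprime to q} f(d) = ∑_{u ∈ (ℤ/qℤ)ˣ} ∑_{d ≡ u} f(d)`. [folklore] -/
theorem sum_filter_coprime_eq_sum_units [NeZero q] (s : Finset ℕ) (f : ℕ → ℝ) :
    ∑ d ∈ s with Nat.Coprime d q, f d =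
      ∑ u : (ZMod q)ˣ, ∑ d ∈ s with ((d : ℕ) : ZMod q) = u, f d := by
  classical
  have h1 : ∑ d ∈ s with Nat.Coprime d q, f d =
      ∑ d ∈ s, f d * (if IsUnit ((d : ℕ) : ZMod q) then (1 : ℝ) else 0) := by
    rw [Finset.sum_filter]
    refine Finset.sum_congr rfl fun d _ => ?_
    by_cases h : Nat.Coprime d q
    · rw [if_pos h, if_pos ((ZMod.isUnit_iff_coprime d q).mpr h), mul_one]
    · rw [if_neg h, if_neg (mt (ZMod.isUnit_iff_coprime d q).mp h), mul_zero]
  rw [h1, sum_mul_apply_natCast_eq s f (fun b => if IsUnit b then (1 : ℝ) else 0),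
    sum_zmod_eq_sum_units _ (fun b hb => by simp [hb])]
  refine Finset.sum_congr rfl fun u _ => ?_
  simp [Units.isUnit]

/-- First term of the discrepancy of a Dirichlet convolution in a primitive class `a (q)`:
`∑_{n ≡ a} (α ⋆ β)(n) = ∑_{u ∈ (ℤ/qℤ)ˣ} (∑_{d ≡ u} α(d)) (∑_{e ≡ u⁻¹ a} β(e))` (for `(a, q) = 1` only
`d` coprime to `q` contribute). [cite: Polymath8a2014, proof of Lemma 3.4 (iii)] -/
theorem sum_congr_mul_apply_eq_sum_units [NeZero q] (α β : ArithmeticFunction ℝ) {X₁ X₂ X : ℕ}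
    (hα : ∀ n, X₁ < n → α n = 0) (hβ : ∀ n, X₂ < n → β n = 0) (hX : X₁ * X₂ ≤ X)
    (a : (ZMod q)ˣ) :
    ∑ n ∈ Icc 1 X with ((n : ℕ) : ZMod q) = a, (α * β) n =
      ∑ u : (ZMod q)ˣ, (∑ d ∈ Icc 1 X₁ with ((d : ℕ) : ZMod q) = u, α d) *
        ∑ e ∈ Icc 1 X₂ with ((e : ℕ) : ZMod q) = ((u⁻¹ * a : (ZMod q)ˣ) : ZMod q), β e := by
  classical
  -- the inner sum as a function of the residue of `d`
  set G : ZMod q → ℝ := fun c => ∑ e ∈ Icc 1 X₂, if c * (e : ZMod q) = a then β e else 0 with hG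
  have h1 : ∑ n ∈ Icc 1 X with ((n : ℕ) : ZMod q) = a, (α * β) n =
      ∑ d ∈ Icc 1 X₁, α d * G (d : ZMod q) := by
    rw [Finset.sum_filter]
    have h2 : ∀ n ∈ Icc 1 X, (if ((n : ℕ) : ZMod q) = a then (α * β) n else 0) =
        (if ((n : ℕ) : ZMod q) = a then (1 : ℝ) else 0) * (α * β) n := fun n _ => by
      rw [boole_mul]
    rw [Finset.sum_congr rfl h2, sum_Icc_mul_apply_eq α β hα hβ hX]
    refine Finset.sum_congr rfl fun d _ => ?_
    rw [hG, Finset.mul_sum]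
    refine Finset.sum_congr rfl fun e _ => ?_
    rw [Nat.cast_mul, boole_mul, mul_ite, mul_zero]
  -- `G` vanishes off the units, and `G u = ∑_{e ≡ u⁻¹ a} β e`
  have hG0 : ∀ b : ZMod q, ¬IsUnit b → (∑ d ∈ Icc 1 X₁ with ((d : ℕ) : ZMod q) = b, α d) * G b = 0 :=
    fun b hb => by
      have : G b = 0 := by
        rw [hG]
        refine Finset.sum_eq_zero fun e _ => ?_
        rw [if_neg]
        intro h
        exact hb (isUnit_of_mul_isUnit_left (h ▸ Units.isUnit a))
      rw [this, mul_zero]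
  have hGu : ∀ u : (ZMod q)ˣ, G u =
      ∑ e ∈ Icc 1 X₂ with ((e : ℕ) : ZMod q) = ((u⁻¹ * a : (ZMod q)ˣ) : ZMod q), β e := fun u => by
    rw [hG, Finset.sum_filter]
    refine Finset.sum_congr rfl fun e _ => ?_
    congr 1
    rw [Units.val_mul, ← Units.eq_inv_mul_iff_mul_eq]
  rw [h1, sum_mul_apply_natCast_eq, sum_zmod_eq_sum_units _ hG0]
  exact Finset.sum_congr rfl fun u _ => by rw [hGu]

/-- Coprime part of a Dirichlet convolution: `∑_{(n,q)=1} (α ⋆ β)(n) = (∑_{(d,q)=1} α(d)) (∑_{(e,q)=1} β(e))`.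
[cite: Polymath8a2014, proof of Lemma 3.4 (iii)] -/
theorem sum_coprime_mul_apply_eq (α β : ArithmeticFunction ℝ) {X₁ X₂ X : ℕ}
    (hα : ∀ n, X₁ < n → α n = 0) (hβ : ∀ n, X₂ < n → β n = 0) (hX : X₁ * X₂ ≤ X) (q : ℕ) :
    ∑ n ∈ Icc 1 X with Nat.Coprime n q, (α * β) n =
      (∑ d ∈ Icc 1 X₁ with Nat.Coprime d q, α d) * ∑ e ∈ Icc 1 X₂ with Nat.Coprime e q, β e := by
  classical
  rw [Finset.sum_filter]
  have h2 : ∀ n ∈ Icc 1 X, (if Nat.Coprime n q then (α * β) n else 0) =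
      (if Nat.Coprime n q then (1 : ℝ) else 0) * (α * β) n := fun n _ => by rw [boole_mul]
  rw [Finset.sum_congr rfl h2, sum_Icc_mul_apply_eq α β hα hβ hX, Finset.sum_filter,
    Finset.sum_filter, Finset.sum_mul_sum]
  refine Finset.sum_congr rfl fun d _ => Finset.sum_congr rfl fun e _ => ?_
  by_cases hd : Nat.Coprime d q
  · by_cases he : Nat.Coprime e q
    · rw [if_pos (Nat.coprime_mul_iff_left.mpr ⟨hd, he⟩), if_pos hd, if_pos he, one_mul]
    · rw [if_neg (fun h => he (Nat.coprime_mul_iff_left.mp h).2), if_neg he, zero_mul, mul_zero]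
  · rw [if_neg (fun h => hd (Nat.coprime_mul_iff_left.mp h).1), if_neg hd, zero_mul, zero_mul]

/-- **Discrepancy of a Dirichlet convolution in a primitive residue class** (the device of
Polymath 8a §3, used for Lemma 3.4 (iii) and displayed in the Type 0 case of the proof of Lemma 2.7:
"`Δ(α_k ⋆ α_S; a (q)) = ∑_{m ∈ (ℤ/qℤ)ˣ} ∑_{ℓ = m (q)} α_S(ℓ) Δ(α_k; m̄ a (q))`"): for `(a, q) = 1`,
`Δ(α ⋆ β; a (q)) = ∑_{u ∈ (ℤ/qℤ)ˣ} (∑_{d ≡ u (q)} α(d)) · Δ(β; u⁻¹ a (q))`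
(here `α`, `β` are supported on `[1, X₁]`, `[1, X₂]` and the discrepancies are taken on `[1, X]`,
`X ≥ X₁ X₂`, resp. `[1, X₂]`). [cite: Polymath8a2014, §3, proof of Lemma 2.7 (Type 0 case) and of Lemma 3.4 (iii)] -/
theorem apDiscrepancy_mul_eq_sum_units [NeZero q] (α β : ArithmeticFunction ℝ) {X₁ X₂ X : ℕ}
    (hα : ∀ n, X₁ < n → α n = 0) (hβ : ∀ n, X₂ < n → β n = 0) (hX : X₁ * X₂ ≤ X)
    (a : (ZMod q)ˣ) :
    apDiscrepancy ⇑(α * β) X q a =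
      ∑ u : (ZMod q)ˣ, (∑ d ∈ Icc 1 X₁ with ((d : ℕ) : ZMod q) = u, α d) *
        apDiscrepancy β X₂ q ((u⁻¹ * a : (ZMod q)ˣ) : ZMod q) := by
  classical
  rw [apDiscrepancy, sum_congr_mul_apply_eq_sum_units α β hα hβ hX a,
    sum_coprime_mul_apply_eq α β hα hβ hX q, sum_filter_coprime_eq_sum_units (Icc 1 X₁) (fun d => α d)]
  simp only [apDiscrepancy, mul_sub, Finset.sum_sub_distrib, Finset.sum_mul, Finset.sum_div, mul_div_assoc]

/-- **Corollary** (the inequality "`|Δ(α ⋆ β, a (r))| ≤ ∑_{b ∈ (ℤ/rℤ)ˣ} |∑_{d ≡ b} α(d)| |Δ(β; b̄ a (r))|`"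
of the proof of Lemma 3.4 (iii), and the bound "`⪅ N_S ∑_{q ≤ Q} sup_b |Δ(α_k; b (q))|`" of the
Type 0 case, per modulus): for `(a, q) = 1`,
`|Δ(α ⋆ β; a (q))| ≤ (∑_d |α(d)|) · B` whenever `|Δ(β; b (q))| ≤ B` for every unit `b`.
[cite: Polymath8a2014, §3, proof of Lemma 3.4 (iii) and of Lemma 2.7 (Type 0 case)] -/
theorem abs_apDiscrepancy_mul_le [NeZero q] (α β : ArithmeticFunction ℝ) {X₁ X₂ X : ℕ}
    (hα : ∀ n, X₁ < n → α n = 0) (hβ : ∀ n, X₂ < n → β n = 0) (hX : X₁ * X₂ ≤ X)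
    (a : (ZMod q)ˣ) {B : ℝ} (hB : ∀ b : (ZMod q)ˣ, |apDiscrepancy β X₂ q b| ≤ B) :
    |apDiscrepancy ⇑(α * β) X q a| ≤ (∑ d ∈ Icc 1 X₁, |α d|) * B := by
  classical
  have hB0 : 0 ≤ B := (abs_nonneg _).trans (hB 1)
  rw [apDiscrepancy_mul_eq_sum_units α β hα hβ hX a]
  calc |∑ u : (ZMod q)ˣ, (∑ d ∈ Icc 1 X₁ with ((d : ℕ) : ZMod q) = u, α d) *
          apDiscrepancy β X₂ q ((u⁻¹ * a : (ZMod q)ˣ) : ZMod q)|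
      ≤ ∑ u : (ZMod q)ˣ, |(∑ d ∈ Icc 1 X₁ with ((d : ℕ) : ZMod q) = u, α d) *
          apDiscrepancy β X₂ q ((u⁻¹ * a : (ZMod q)ˣ) : ZMod q)| := Finset.abs_sum_le_sum_abs _ _
    _ ≤ ∑ u : (ZMod q)ˣ, (∑ d ∈ Icc 1 X₁ with ((d : ℕ) : ZMod q) = u, |α d|) * B := by
        refine Finset.sum_le_sum fun u _ => ?_
        rw [abs_mul]
        exact mul_le_mul (Finset.abs_sum_le_sum_abs _ _) (hB _) (abs_nonneg _)
          (Finset.sum_nonneg fun _ _ => abs_nonneg _)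
    _ = (∑ d ∈ Icc 1 X₁ with Nat.Coprime d q, |α d|) * B := by
        rw [← Finset.sum_mul, sum_filter_coprime_eq_sum_units]
    _ ≤ (∑ d ∈ Icc 1 X₁, |α d|) * B := by
        gcongr
        exact Finset.filter_subset _ _

end Residues

section SiegelWalfisz

variable {q : ℕ}

/-- **Lemma 3.4 (iii), the general case** (Polymath 8a §3: "if `α, β` are coefficient sequences
located at scales `N, M` respectively … and `β` satisfies the Siegel–Walfisz property, then so does
`α ⋆ β`"), as the uniform inequality its proof establishes: restricting to integers coprime to `r`
commutes with Dirichlet convolution ("We replace `α, β` by their restriction to integers coprime to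
`qr` …, which allows us to remove the constraint `1_{(n,q)=1}`" — here `(de, r) = 1 ⟺ (d, r) = 1 ∧
(e, r) = 1`), so by `abs_apDiscrepancy_mul_le`, for `(a, q) = 1`,
`|Δ((α ⋆ β) 1_{(·,r)=1}; a (q))| ≤ (∑_d |α(d)|) · max_{b ∈ (ℤ/qℤ)ˣ} |Δ(β 1_{(·,r)=1}; b (q))|`.
(With `∑_d |α(d)| ⪅ N` and the Siegel–Walfisz bound `τ(qr)^{O(1)} M log^{−A} x` for `β` this is the
printed `|Δ(α ⋆ β; a (r))| ≪ τ(r)^{O(1)} MN log^{−B+O(1)} x`; the paper's sharper route through the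
Brun–Titchmarsh bound (1.5) is not needed for this conclusion.)
[cite: Polymath8a2014, Lemma 3.4 (iii) and its proof] -/
theorem abs_apDiscrepancy_coprime_mul_le [NeZero q] (α β : ArithmeticFunction ℝ) {X₁ X₂ X : ℕ}
    (hα : ∀ n, X₁ < n → α n = 0) (hβ : ∀ n, X₂ < n → β n = 0) (hX : X₁ * X₂ ≤ X) (r : ℕ)
    (a : (ZMod q)ˣ) {B : ℝ}
    (hB : ∀ b : (ZMod q)ˣ,
      |apDiscrepancy (fun n => if Nat.Coprime n r then β n else 0) X₂ q b| ≤ B) :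
    |apDiscrepancy (fun n => if Nat.Coprime n r then (α * β) n else 0) X q a| ≤
      (∑ d ∈ Icc 1 X₁, |α d|) * B := by
  classical
  -- the restrictions to integers coprime to `r`, as arithmetic functions
  let αr : ArithmeticFunction ℝ :=
    ⟨fun n => if Nat.Coprime n r then α n else 0, by simp⟩
  let βr : ArithmeticFunction ℝ :=
    ⟨fun n => if Nat.Coprime n r then β n else 0, by simp⟩
  have hαr : ∀ n, αr n = if Nat.Coprime n r then α n else 0 := fun n => rfl
  have hβr : ∀ n, βr n = if Nat.Coprime n r then β n else 0 := fun n => rfl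
  -- restriction commutes with convolution
  have hconv : ∀ n, (if Nat.Coprime n r then (α * β) n else 0) = (αr * βr) n := by
    intro n
    rw [ArithmeticFunction.mul_apply, ArithmeticFunction.mul_apply]
    by_cases hn : Nat.Coprime n r
    · rw [if_pos hn]
      refine Finset.sum_congr rfl fun p hp => ?_
      have hpn := (Nat.mem_divisorsAntidiagonal.mp hp).1
      have hcop : Nat.Coprime (p.1 * p.2) r := by rwa [hpn]
      rw [hαr, hβr, if_pos (Nat.coprime_mul_iff_left.mp hcop).1,
        if_pos (Nat.coprime_mul_iff_left.mp hcop).2]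
    · rw [if_neg hn]
      symm
      refine Finset.sum_eq_zero fun p hp => ?_
      have hpn := (Nat.mem_divisorsAntidiagonal.mp hp).1
      rw [hαr, hβr]
      by_cases h1 : Nat.Coprime p.1 r
      · by_cases h2 : Nat.Coprime p.2 r
        · exact absurd (hpn ▸ Nat.coprime_mul_iff_left.mpr ⟨h1, h2⟩) hn
        · rw [if_neg h2, mul_zero]
      · rw [if_neg h1, zero_mul]
  have hfun : (fun n => if Nat.Coprime n r then (α * β) n else 0) = ⇑(αr * βr) := funext hconv
  have hαr0 : ∀ n, X₁ < n → αr n = 0 := fun n hn => by rw [hαr, hα n hn, ite_self]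
  have hβr0 : ∀ n, X₂ < n → βr n = 0 := fun n hn => by rw [hβr, hβ n hn, ite_self]
  have hBr : ∀ b : (ZMod q)ˣ, |apDiscrepancy βr X₂ q b| ≤ B := hB
  rw [hfun]
  refine (abs_apDiscrepancy_mul_le αr βr hαr0 hβr0 hX a hBr).trans ?_
  have hB0 : 0 ≤ B := (abs_nonneg _).trans (hB 1)
  refine mul_le_mul_of_nonneg_right (Finset.sum_le_sum fun d _ => ?_) hB0
  rw [hαr]
  split_ifs
  · exact le_rfl
  · rw [abs_zero]; exact abs_nonneg _

end SiegelWalfisz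

end Polymath8a

end Literature.NumberTheory.Sieve
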